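import Mathlib
import HarnessLib
import Summits.HubbardSuperconductivity.HubbardSuperconductivity.Theorems.KLProgrammeKLRegimeEngineScaleZeroTwoLegBareFrameJets
import Summits.HubbardSuperconductivity.HubbardSuperconductivity.Theorems.KLProgrammeKLRegimeEngineTwoLegStepV17FDoorPkg
import Summits.HubbardSuperconductivity.HubbardSuperconductivity.Theorems.KLProgrammeKLRegimeSplitTwoLegReadJetsStruct
import Summits.HubbardSuperconductivity.HubbardSuperconductivity.Theorems.KLProgrammeKLRegimeTwoLegReadJetDefs

/-!
# K3 gen-7F engine-flow child `KLRegimeEngineV17F` (stmt-HubbardSuperconductivity-20368), stub (M) at the BARE FRAME `K₀ = 0`: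
# the two-leg slot `TwoLegStepV17F … 0` ASSEMBLED from the bare covariance moments

Cell gate-hubbard-kl, seat p1b (g8), (M) owner.  Composition of
* the bare-frame grid sums and sup-jets (`…EngineScaleZeroTwoLegBareFrame[Jets]`, p1b: `twoLeg_momentumSizes_frameZero` — `‖DᵏI_L[σ₀]‖ ≤ μc k·U²`,
  `μc k = 2^{k+10}e¹⁸κ₀⁴·a k`, and `‖I_L[σ₀]‖ ≤ (128/3)e⁹κ₀²|U|`; `abs_klFieldStrength_frameZero_sub_one_le`),
* k3c3-p3's structured curve-jet link `abs_iteratedDeriv_comp_fermiPointLp_le_curveJetBar` (tables `readJetC μc`, `readJetC' R μc`; at the bare frame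
  `K = 0`, depth `N = 0`, scale `n = 0`),
* p2's predicate `TwoLegReadJetBound` (p525183) and r2d-p1's (M) door `twoLegStepV17F_zero_of_jets_sepTubeGradient_nestedLegs` (p526589):
**`twoLegReadJetBound_bareFrame`** — `TwoLegReadJetBound L M cN (readJetC' R μc) β U μ 0 0` with `cN 0 = (128/3)e⁹κ₀²`, `cN k = readJetC μc k` (k ≥ 1);
**`twoLegStepV17F_zero_bareFrame`** — `TwoLegStepV17F L M G P Q R β U μ 0` from: the normalised `(1+diam)ᵏ`-weighted row/column sizes `a k`
(`k ≤ 4`) of the BARE scale-`0` grid covariance `S_{4M}ᵀ C⁰_{>e₀} S_{4M}` with the smallnesses `16e⁹κ₀²·klScaleZeroA0·|U| ≤ 1/4`,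
`16e⁹κ₀²·(a k)·|U| ≤ 1/2`; the package inequalities `cN ≤ G.S`, `readJetC' R μc ≤ Q.S'`; the two (E3d/e) fits `2^{10}e¹⁸κ₀⁴(a 1)U² ≤ cz|U|`,
`2^{11}e¹⁸κ₀⁴(a 1)U² + (4/3)Gfr₁U² ≤ cz|U|·cDtmin/2`; and the two nested-leg volume rates (VL lanes).  NO frame, NO counterterm, NO (E3c), NO MS.
Proofs only; no definitions.  References: BGM 2006 §3 (3.2)–(3.3) [cite: BenfattoGiulianiMastropietro2006].
-/

noncomputable section

namespace Summit.HubbardSuperconductivity.HubbardSuperconductivity.Theorems.EngineV8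

set_option linter.dupNamespace false -- summit = problem name (single-conjunct summit), D-0017

open Real Finset Literature.MathematicalPhysics.QuantumLattice Literature.Probability.LatticeModels
open Literature.MathematicalPhysics.QuantumLattice.FermiRG Literature.MathematicalPhysics.QuantumLattice.BandSectorCounting
open Literature.Probability.LatticeModels.BattleFederbush GrassmannAlgebra
open Summit.HubbardSuperconductivity.HubbardSuperconductivity.Theorems.KLProgrammeLegKernels
open Summit.HubbardSuperconductivity.HubbardSuperconductivity.Theorems.DispersionFlow
open Summit.HubbardSuperconductivity.HubbardSuperconductivity.Theorems.PerturbedFermiCurve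
open Summit.HubbardSuperconductivity.HubbardSuperconductivity.Theorems.KLRegimeSplit
open Summit.HubbardSuperconductivity.HubbardSuperconductivity.Theorems.TwoLegFourier

section BareFrame

variable {L M : ℕ} [NeZero L] [NeZero M] {R : RenConsts} {μ U β c : ℝ}

omit [NeZero L] in
/-- `gridLabelWt = (1 + diam)¹` as a diameter weight (to read the `k = 1` covariance size in the W-chain's `wt₁` currency). -/
theorem gridLabelWt_eq_polyWt_one {N : ℕ} (β' : ℝ) (S : Finset (ZMod N × TorusSite 2 L)) :
    gridLabelWt L N β' S = diamWeight (fun s => (1 + 1 * s) ^ 1) (gridLabelDist L N β') S := by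
  rw [diamWeight, gridLabelWt_apply, one_mul, pow_one]

/-- **`TwoLegReadJetBound` AT THE BARE FRAME** (stub 6-F's currency at `K₀ = 0`, scale `0`): with `μc k = 2^{k+10}·e¹⁸·κ₀⁴·a k` from the normalised
`(1+diam)ᵏ`-weighted sizes `a k` (`k ≤ 4`) of the bare scale-`0` grid covariance, tables `cN 0 = (128/3)e⁹κ₀²`, `cN k = readJetC μc k` (`k ≥ 1`) and
`readJetC' R μc`. -/
theorem twoLegReadJetBound_bareFrame (hRW : R.WF) (hc : 0 < c) (hcle : c ≤ klCurveC3 R) (hμ : μ ∈ klWindowC) (hU : 0 < U)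
    (hUle : U ≤ klCurveU0 R) (hU1 : U ≤ 1) (hβ : klBetaMin ≤ β) (hβc : β ≤ Real.exp (c / U ^ 2)) (hL : klEngL₃ β U ≤ L)
    (hM : klEngM₃ β U L ≤ M) (hsmall₀ : 16 * Real.exp 1 ^ 9 * Real.sqrt (2 * (7 + 1606732)) ^ 2 * klScaleZeroA0 * |U| ≤ 1 / 4)
    {a : ℕ → ℝ} (ha : ∀ k, 0 < a k)
    (hrow : ∀ k, 1 ≤ k → k ≤ 4 → ∀ X, ∑ Y, ‖((hubbardGridSub L M β (2 * (2 * M))).transpose * hubbardCovAboveCT L M β μ 0 0 klE0 *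
        hubbardGridSub L M β (2 * (2 * M))) X Y‖ *
        diamWeight (fun s => (1 + 1 * s) ^ k) (gridLabelDist L (2 * (2 * M)) β) {gridLegPos X, gridLegPos Y} ≤
          a k * ((2 * (2 * M) : ℕ) : ℝ) / β)
    (hcol : ∀ k, 1 ≤ k → k ≤ 4 → ∀ Y, ∑ X, ‖((hubbardGridSub L M β (2 * (2 * M))).transpose * hubbardCovAboveCT L M β μ 0 0 klE0 *
        hubbardGridSub L M β (2 * (2 * M))) X Y‖ *
        diamWeight (fun s => (1 + 1 * s) ^ k) (gridLabelDist L (2 * (2 * M)) β) {gridLegPos X, gridLegPos Y} ≤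
          a k * ((2 * (2 * M) : ℕ) : ℝ) / β)
    (hsmall : ∀ k, 1 ≤ k → k ≤ 4 → 16 * Real.exp 1 ^ 9 * Real.sqrt (2 * (7 + 1606732)) ^ 2 * a k * |U| ≤ 1 / 2) :
    TwoLegReadJetBound L M
      (fun k => if k = 0 then 128 / 3 * Real.exp 1 ^ 9 * Real.sqrt (2 * (7 + 1606732)) ^ 2
        else readJetC (fun l => (2 : ℝ) ^ (l + 10) * Real.exp 1 ^ 18 * Real.sqrt (2 * (7 + 1606732)) ^ 4 * a l) k)
      (readJetC' R (fun l => (2 : ℝ) ^ (l + 10) * Real.exp 1 ^ 18 * Real.sqrt (2 * (7 + 1606732)) ^ 4 * a l)) β U μ 0 0 := by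
  have hR : ∀ j, 0 ≤ R.Gfr j := hRW.2.2
  set μc : ℕ → ℝ := fun l => (2 : ℝ) ^ (l + 10) * Real.exp 1 ^ 18 * Real.sqrt (2 * (7 + 1606732)) ^ 4 * a l with hμc
  have hμc0 : ∀ l, 0 ≤ μc l := fun l => by rw [hμc]; have := ha l; positivity
  obtain ⟨h0, hk⟩ := twoLeg_momentumSizes_frameZero (L := L) (M := M) hRW 0 hμ hU hβ hL hM hsmall₀ 4 (fun k _ _ => ha k) hrow hcol hsmall
  have hK0 : FrameOK R U 0 μ 0 := klFrameOK_zeroC hRW U 0 hμ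
  have hK0' : FrameOK R U (nScales β) μ 0 := klFrameOK_zeroC hRW U (nScales β) hμ
  -- structured jets of `ν₀(0)` (value from the zeroth size; orders 1–4 from k3c3-p3's curve link at depth 0, scale 0)
  obtain ⟨hC, hval⟩ := twoLeg_readJets_frameZero (L := L) (M := M) hR hc hcle hU hUle hβ hβc hμ hK0'
    (m := fun k => if k = 0 then 128 / 3 * Real.exp 1 ^ 9 * Real.sqrt (2 * (7 + 1606732)) ^ 2 * |U| else μc k * U ^ 2)
    (fun k hk4 q => by
      rcases Nat.eq_zero_or_pos k with rfl | hkpos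
      · simpa only [if_true] using h0 q
      · have hkne : k ≠ 0 := by omega
        simpa only [hkne, if_false, hμc] using hk k hkpos hk4 q)
  set F : Momentum → ℝ := evalM (symInterp L (klLocSelfEnergyRe L M β U μ 0 0)) with hF
  have hFc : ContDiff ℝ 4 F := contDiff_evalM _
  have hνF : klLocalPart L M β U μ 0 0 = F ∘ fun θ : ℝ => (WithLp.toLp 2 (klFermiPoint μ 0 θ) : Momentum) := by
    have h := klLocalPart_zero_sub_frame_eq_comp (L := L) (M := M) β U μ (0 : TrigPolyC4v)
    have hl : (fun θ => klLocalPart L M β U μ 0 0 θ - (0 : TrigPolyC4v).eval (klFermiPoint μ 0 θ)) = klLocalPart L M β U μ 0 0 := by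
      funext θ; simp
    rw [hl] at h
    rw [h]
    congr 1
    funext p
    simp [hF, evalM_apply]
  refine ⟨hC, fun k hk4 θ => ?_⟩
  rcases Nat.eq_zero_or_pos k with rfl | hkpos
  · -- order 0: the value
    rw [iteratedDeriv_zero]
    refine ((hval θ).1).trans (le_of_eq ?_)
    simp [curveJetBar, uPow, readJetC']
  · -- orders 1–4: k3c3-p3's structured link at the bare frame
    have hkne : k ≠ 0 := by omega
    have hcurve := abs_iteratedDeriv_comp_fermiPointLp_le_curveJetBar (n := 0) hR hc hcle hU hUle hU1 hβ hβc hμ hK0 le_rfl (Nat.zero_le _)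
      hFc hμc0 θ (fun l hl1 hl4 => by
        have h := hk l hl1 hl4 (WithLp.toLp 2 (klFermiPoint μ 0 θ))
        simpa only [hμc, Int.mul_zero, zpow_zero, mul_one, Nat.cast_zero, mul_zero] using h) hkpos hk4
    rw [show (fun θ : ℝ => klLocalPart L M β U μ 0 0 θ) = klLocalPart L M β U μ 0 0 from rfl, hνF]
    refine hcurve.trans (le_of_eq ?_)
    simp only [curveJetBar, hkne, if_false]

/-- **THE TWO-LEG SLOT OF THE ENGINE-FLOW CHILD AT SCALE `0` (stub (M), bare frame `K₀ = 0`) FROM THE BARE COVARIANCE MOMENTS.**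
`TwoLegStepV17F L M G P Q R β U μ 0` from: the regime binders; the normalised `(1+diam)ᵏ`-weighted row/column sizes `a k` (`k ≤ 4`) of
`S_{4M}ᵀ C⁰_{>e₀} S_{4M}` with their smallnesses; the package inequalities for the jet tables; the field-strength and slope fits at `a 1`; and the two
nested-leg volume rates of the scale-`0` local part (cutoff leg, spatial nested leg — VL lanes; empty histories). -/
theorem twoLegStepV17F_zero_bareFrame (G : GeoConsts) (Q : EngConsts) {P : SplitConsts} (hRW : R.WF) (hc : 0 < c) (hcle : c ≤ klCurveC3 R)
    (hμ : μ ∈ klWindowC) (hU : 0 < U) (hUle : U ≤ klCurveU0 R) (hU1 : U ≤ 1) (hβ : klBetaMin ≤ β) (hβc : β ≤ Real.exp (c / U ^ 2))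
    (hL : klEngL₃ β U ≤ L) (hM : klEngM₃ β U L ≤ M) (hCL : 0 ≤ Q.CL β 0)
    (hsmall₀ : 16 * Real.exp 1 ^ 9 * Real.sqrt (2 * (7 + 1606732)) ^ 2 * klScaleZeroA0 * |U| ≤ 1 / 4)
    {a : ℕ → ℝ} (ha : ∀ k, 0 < a k)
    (hrow : ∀ k, 1 ≤ k → k ≤ 4 → ∀ X, ∑ Y, ‖((hubbardGridSub L M β (2 * (2 * M))).transpose * hubbardCovAboveCT L M β μ 0 0 klE0 *
        hubbardGridSub L M β (2 * (2 * M))) X Y‖ *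
        diamWeight (fun s => (1 + 1 * s) ^ k) (gridLabelDist L (2 * (2 * M)) β) {gridLegPos X, gridLegPos Y} ≤
          a k * ((2 * (2 * M) : ℕ) : ℝ) / β)
    (hcol : ∀ k, 1 ≤ k → k ≤ 4 → ∀ Y, ∑ X, ‖((hubbardGridSub L M β (2 * (2 * M))).transpose * hubbardCovAboveCT L M β μ 0 0 klE0 *
        hubbardGridSub L M β (2 * (2 * M))) X Y‖ *
        diamWeight (fun s => (1 + 1 * s) ^ k) (gridLabelDist L (2 * (2 * M)) β) {gridLegPos X, gridLegPos Y} ≤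
          a k * ((2 * (2 * M) : ℕ) : ℝ) / β)
    (hsmall : ∀ k, 1 ≤ k → k ≤ 4 → 16 * Real.exp 1 ^ 9 * Real.sqrt (2 * (7 + 1606732)) ^ 2 * a k * |U| ≤ 1 / 2)
    -- the package inequalities for the jet tables
    (hpk : ∀ k, (if k = 0 then 128 / 3 * Real.exp 1 ^ 9 * Real.sqrt (2 * (7 + 1606732)) ^ 2
        else readJetC (fun l => (2 : ℝ) ^ (l + 10) * Real.exp 1 ^ 18 * Real.sqrt (2 * (7 + 1606732)) ^ 4 * a l) k) ≤ G.S k)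
    (hpk' : ∀ k, readJetC' R (fun l => (2 : ℝ) ^ (l + 10) * Real.exp 1 ^ 18 * Real.sqrt (2 * (7 + 1606732)) ^ 4 * a l) k ≤ Q.S' k)
    -- the (E3d) and (E3e) fits at the `k = 1` covariance size
    (hfitz : (2 : ℝ) ^ 10 * Real.exp 1 ^ 18 * Real.sqrt (2 * (7 + 1606732)) ^ 4 * a 1 * U ^ 2 ≤ R.cz * |U|)
    (hfit1 : (2 : ℝ) ^ 11 * Real.exp 1 ^ 18 * Real.sqrt (2 * (7 + 1606732)) ^ 4 * a 1 * U ^ 2 + 4 / 3 * R.Gfr 1 * U ^ 2 ≤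
      R.cz * |U| * (cDtmin (-1.2) (-0.05) / 2))
    -- (C) the two nested-leg rates of the scale-0 local part (empty histories)
    (hcut : ∀ (Mq : ℕ → ℕ) (L₁ M₁ M₂ : ℕ) [NeZero L₁] [NeZero M₁] [NeZero M₂], L ≤ L₁ → Q.M0 β L₁ ≤ M₁ → Mq L₁ ≤ M₁ → M₁ ≤ M₂ →
      (∀ j < 0, histV17F L₁ M₁ G P Q R β U μ j ∧ TwoLegSlopes L₁ M₁ R β U μ (klFlowFrameU L₁ M₁ β U μ j) j) →
      (∀ j < 0, histV17F L₁ M₂ G P Q R β U μ j ∧ TwoLegSlopes L₁ M₂ R β U μ (klFlowFrameU L₁ M₂ β U μ j) j) →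
        ∀ θ : ℝ, |klLocalPart L₁ M₁ β U μ 0 0 θ - klLocalPart L₁ M₂ β U μ 0 0 θ| ≤ Q.CL β 0 / 4 / L₁)
    (hsp : ∀ (Mq : ℕ → ℕ) (L₁ L₂ M₂ : ℕ) [NeZero L₁] [NeZero L₂] [NeZero M₂], L ≤ L₁ → L₁ ∣ L₂ → Q.M0 β L₁ ≤ M₂ → Mq L₁ ≤ M₂ →
      Q.M0 β L₂ ≤ M₂ → Mq L₂ ≤ M₂ →
      (∀ j < 0, histV17F L₁ M₂ G P Q R β U μ j ∧ TwoLegSlopes L₁ M₂ R β U μ (klFlowFrameU L₁ M₂ β U μ j) j) →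
      (∀ j < 0, histV17F L₂ M₂ G P Q R β U μ j ∧ TwoLegSlopes L₂ M₂ R β U μ (klFlowFrameU L₂ M₂ β U μ j) j) →
        ∀ θ : ℝ, |klLocalPart L₁ M₂ β U μ 0 0 θ - klLocalPart L₂ M₂ β U μ 0 0 θ| ≤ Q.CL β 0 / 4 / L₁) :
    TwoLegStepV17F L M G P Q R β U μ 0 := by
  have hR : ∀ j, 0 ≤ R.Gfr j := hRW.2.2
  have hβ0 : 0 < β := lt_of_lt_of_le (by norm_num [klBetaMin]) hβ
  obtain ⟨hC, hjets⟩ := twoLegReadJetBound_bareFrame (L := L) (M := M) hRW hc hcle hμ hU hUle hU1 hβ hβc hL hM hsmall₀ ha hrow hcol hsmall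
  -- (B) field strength and the tube gradient at the bare frame, from the `k = 1` size
  have hrow1 : ∀ X, ∑ Y, ‖((hubbardGridSub L M β (2 * (2 * M))).transpose * hubbardCovAboveCT L M β μ 0 0 klE0 *
      hubbardGridSub L M β (2 * (2 * M))) X Y‖ * gridLabelWt L (2 * (2 * M)) β {gridLegPos X, gridLegPos Y} ≤ a 1 * ((2 * (2 * M) : ℕ) : ℝ) / β :=
    fun X => by simpa only [gridLabelWt_eq_polyWt_one] using hrow 1 le_rfl (by norm_num) X
  have hcol1 : ∀ Y, ∑ X, ‖((hubbardGridSub L M β (2 * (2 * M))).transpose * hubbardCovAboveCT L M β μ 0 0 klE0 *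
      hubbardGridSub L M β (2 * (2 * M))) X Y‖ * gridLabelWt L (2 * (2 * M)) β {gridLegPos X, gridLegPos Y} ≤ a 1 * ((2 * (2 * M) : ℕ) : ℝ) / β :=
    fun Y => by simpa only [gridLabelWt_eq_polyWt_one] using hcol 1 le_rfl (by norm_num) Y
  have hz : ∀ k ∈ klShell L μ 0 0, |klFieldStrength L M β U μ 0 0 k - 1| ≤ R.cz * |U| := fun k _ =>
    (abs_klFieldStrength_frameZero_sub_one_le (L := L) (M := M) hRW 0 hμ hU hβ hL hM (ha 1) hrow1 hcol1 (hsmall 1 le_rfl (by norm_num)) k).trans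
      hfitz
  obtain ⟨-, hk⟩ := twoLeg_momentumSizes_frameZero (L := L) (M := M) hRW 0 hμ hU hβ hL hM hsmall₀ 4 (fun k _ _ => ha k) hrow hcol hsmall
  have hm₁' : ∀ q : Momentum, |frameLevel μ 0 q| ≤ klScale klE0 0 →
      ‖fderiv ℝ (evalM (symInterp L (fun p => klLocSelfEnergyRe L M β U μ 0 0 p - (0 : TrigPolyC4v).eval (latticeMomentum L p)))) q‖ ≤
        (2 : ℝ) ^ 11 * Real.exp 1 ^ 18 * Real.sqrt (2 * (7 + 1606732)) ^ 4 * a 1 * U ^ 2 := fun q _ => by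
    have h := hk 1 le_rfl (by norm_num) q
    rw [norm_iteratedFDeriv_one] at h
    simpa only [TrigPolyC4v.eval_zero, sub_zero] using h
  exact twoLegStepV17F_zero_of_jets_sepTubeGradient_nestedLegs G Q hR hc hcle hμ hU hUle hβ hβc hL (klFrameOK_zeroC hRW U (nScales β) hμ) hCL
    hpk hpk' hC hjets hz hm₁' hfit1 hcut hsp

end BareFrame

end Summit.HubbardSuperconductivity.HubbardSuperconductivity.Theorems.EngineV8

end
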